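import Literature.NumberTheory.EllipticCurves.CastellaGrossiSkinner2025.TwoLineEulerCharacteristic
import Literature.NumberTheory.EllipticCurves.CastellaGrossiSkinner2025.PerrinRiouMainConjectureProofs
import Literature.NumberTheory.EllipticCurves.CastellaGrossiSkinner2025.IsogenyInvariance
import Literature.NumberTheory.EllipticCurves.CastellaGrossiSkinner2025.GreenbergPAdicLFunction
import Literature.NumberTheory.EllipticCurves.CastellaGrossiLeeSkinner2022.AnticyclotomicControlTorsionFree
import Literature.NumberTheory.EllipticCurves.CastellaGrossiLeeSkinner2022.IMC2DivisibilityAndBDPValueFrame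
import Literature.NumberTheory.EllipticCurves.KellerYin2024.AnomalousAnticyclotomicMainConjecture
import Literature.NumberTheory.EllipticCurves.NonvanishingTwistsBumpFriedbergHoffstein
import Literature.NumberTheory.EllipticCurves.Rank1Residual.X1MainConjecture
import Literature.NumberTheory.EllipticCurves.AtkinLehnerFrickeLevelProofs
import Literature.NumberTheory.EllipticCurves.AnalyticRankModularityProofs
import Literature.NumberTheory.EllipticCurves.YanZhu2026.GreenbergMainTheoremsAnyRootGuarded
import Literature.NumberTheory.EllipticCurves.YanZhu2026.GreenbergDivisibilityProofs
import Literature.NumberTheory.EllipticCurves.YanZhu2026.TwistGoodOrdinaryProofs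
import Literature.NumberTheory.EllipticCurves.KatoRankBoundProofs
import Summits.BirchSwinnertonDyer.BirchSwinnertonDyer.Theorems.SmallImageMuTransferMuZeroCMKatzFrame
import Summits.BirchSwinnertonDyer.BirchSwinnertonDyer.Theorems.EisensteinPrimesTwoVariableGeneratorPair
import Summits.BirchSwinnertonDyer.BirchSwinnertonDyer.Theorems.SignedBaseChangeTwistPairGreenbergProductDivisibilityStubFrameData
import Summits.BirchSwinnertonDyer.Rank1Residual.X11b.KolyvaginHpointsAssembly
import Literature.NumberTheory.EllipticCurves.ZpExtensionUnitTwistProofs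
import Literature.NumberTheory.EllipticCurves.ZpExtensionAnticyclotomicHoldsProofs
import Summits.BirchSwinnertonDyer.Rank1Residual.X1.GoodLatticeExists
import Summits.BirchSwinnertonDyer.Rank1Residual.X1.KellerYinGoodLattice
import Summits.BirchSwinnertonDyer.Rank1Residual.Partition.AnticyclotomicControlJSWEmbAt
import Literature.NumberTheory.EllipticCurves.IsogenyGroundFieldExtension
import Literature.NumberTheory.EllipticCurves.IsogenyMordellWeilRankProofs
import Literature.NumberTheory.EllipticCurves.SelmerCorankIsogenyProofs
import Literature.NumberTheory.EllipticCurves.IwasawaLeadingTermProofs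
import Literature.NumberTheory.EllipticCurves.HeegnerPointsClassesProofs
import Literature.NumberTheory.EllipticCurves.HeegnerPointsRationalityGeneralLevelProofs
import Literature.NumberTheory.EllipticCurves.HeegnerPointsImaginaryQuadraticProofs
import Literature.NumberTheory.QuadraticFields.HeegnerCondition
import Literature.NumberTheory.EllipticCurves.Rubin1991.TwoVariableCMLines
import Literature.NumberTheory.EllipticCurves.AnticyclotomicRankinSelbergPAdicLFunction
import Literature.NumberTheory.EllipticCurves.ModularityVersionApProofs
import Literature.NumberTheory.EllipticCurves.ModularCurveManinSemistableBridgeProofs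
import Summits.BirchSwinnertonDyer.BirchSwinnertonDyer.Theorems.SignedBaseChangeK2RDivisibilityDescent
import Literature.NumberTheory.EllipticCurves.IsogenySelmerInfty
import Literature.NumberTheory.EllipticCurves.GreenbergVatsal2000.GreenbergSelmerGroups
import Literature.NumberTheory.EllipticCurves.Castella2018.AnticyclotomicSelmerDualModuleFinite
import Literature.NumberTheory.EllipticCurves.IwasawaDualFunctorialityProofs
import Literature.NumberTheory.EllipticCurves.IsogenyDualProofs
import Literature.NumberTheory.EllipticCurves.Kato2004.DivisibilityInputsZetaLine
import Literature.NumberTheory.EllipticCurves.KatoDivisibilityColemanKernelSkeletonProofs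
import Summits.BirchSwinnertonDyer.BirchSwinnertonDyer.Theorems.EisensteinPrimesMazurMCOnX1RankZeroInterludeRoadBReduction
import Summits.BirchSwinnertonDyer.BirchSwinnertonDyer.Theorems.EisensteinPrimesMazurMCOnX1RankZeroInterludeTwoLineTransport
import Summits.BirchSwinnertonDyer.BirchSwinnertonDyer.Theorems.EisensteinPrimesMazurMCOnX1RankZeroInterludeDefs
import HarnessLib

/-!
# Crux `MazurMCOnX1RankZero` (item stmt-BirchSwinnertonDyer-19035), line `interlude_with_torsion`: FRAME EXISTENCE and S1⁺ ⊕ GV (the characteristic value on the cyclotomic line equals the Greenberg value)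

Cell `bsd-eis` (host `run/shared/lean/pub/bsd-eis/`), LEAD `cruxlead-19035` (g0); `--supports` stmt-BirchSwinnertonDyer-19035 as a
HELPER. Part of the move of the SORRY-FREE recomposition of the skeleton of record v8
(`Cruxes/MazurMCOnX1RankZero/Lines/interlude_with_torsion.lean`; mathematics by the ideator bsd-idea-11 g6–g15 and, for the descent, LEAD
bsd-line-x1-p2 — carried VERBATIM over the tree currencies of `Theorems/…InterludeDefs.lean`) into `Theorems/`, so that crux 5
obtains a BY-NAME conditional closure in the tree whose hypotheses are token-identical to the registered stubs. Kernel-checked;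
every theorem here is either unconditional plumbing or an implication between the line's currencies; NOTHING is asserted about BSD,
Mazur's main conjecture or IMC2, and no registered stub is proved here.

WHAT. `frameData_of_publishedII : PublishedFactsII → FrameDataExists` (Yan–Zhu Thm. 3.9 / CGS Thm. 2.4.2 at an adapted pair through
`(κ γ, 0)`); `plusCharValue_of_published : PublishedFacts → PublishedFactsII → CGS Prop. 3.4.2 → MinusLineValueClass →
PlusCharValueEqGreenbergValue` (CGS §5 Step 1 read at `γ⁻ ↦ 1` with Prop. 2.4.5 and CGLS Thm. 5.1.3).
[cite: CastellaGrossiSkinner2025, Thm. 2.4.2, Lemma 2.4.4, Prop. 2.4.5, Prop. 3.4.2, §5 Step 1] [cite: YanZhu2024MainConjNonCM, Thm. 3.9, Def. 3.11, Prop. 3.14]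
[cite: CastellaGrossiLeeSkinner2022, Thm. 5.1.3]
-/

set_option linter.dupNamespace false
set_option autoImplicit false

noncomputable section

open scoped Classical MatrixGroups ModularForm

open CongruenceSubgroup WeierstrassCurve NumberField IsDedekindDomain Field
  Literature.NumberTheory.EllipticCurves Literature.NumberTheory.EllipticCurves.ModularForms
  Literature.NumberTheory.EllipticCurves.Rank1Residual Literature.NumberTheory.GaloisRepresentations
  Literature.NumberTheory.EllipticCurves.CyclotomicZp Literature.NumberTheory.EllipticCurves.Castella2018
  Literature.NumberTheory.QuadraticFields

namespace Summit.BirchSwinnertonDyer.BirchSwinnertonDyer.Theorems.InterludeWithTorsion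

/-- **PROVED (rev 2): a Greenberg frame exists at every node** (was `stub_frameData`, S plumbing; long form: memo Appendix H): YZ
Thm. 3.9/Def. 3.11 existence at an ADAPTED pair through `(κ γ, 0)` (the node's `κ` is a unit twist of the line restricted from `ℚ`, so
`(κ, κ₂)` is jointly onto `ℤ_p²`), primes `v ≠ v̄ ∣ p`, the embedding datum inducing `v`, `GoodOrd` from `Anom`, `(N, D_K) = 1` from Heegner.
[cite: CastellaGrossiSkinner2025, Thm. 2.4.2, Lemma 2.4.4] [cite: YanZhu2024MainConjNonCM, Thm. 3.9, Def. 3.11] [cite: Washington1997, §13.1] -/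
theorem frameData_of_publishedII : PublishedFactsII → FrameDataExists := by
  intro hII W _ _ p _ K _ _ κ γ h hN f hf hD
  have hp : (p : ℕ).Prime := Fact.out
  have hp2 : p ≠ 2 := by have := h.two_lt; omega
  have hK : IsImaginaryQuadratic K := h.iq
  haveI : IsTotallyComplex K := hK.2
  -- (1) the two primes above the split `p`, and the embedding datum inducing `v`
  obtain ⟨v, vbar, hv, hvbar, hne⟩ :=
    Summit.BirchSwinnertonDyer.BirchSwinnertonDyer.Theorems.SignedBaseChangeK1FrameData.exists_pair_of_ncard_primesOver_eq_two
      (K := K) hp h.split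
  obtain ⟨ιC, hιC⟩ :=
    Summit.BirchSwinnertonDyer.BirchSwinnertonDyer.Theorems.SignedBaseChangeK1FrameData.exists_iota hK v hv
  -- (2) the node's cyclotomic `κ` is fixed under conjugation by `Γ_ℚ` (unit twist of the restricted line)
  obtain ⟨κc, γc, hcycc, -, hfixc, -⟩ :=
    Summit.BirchSwinnertonDyer.BirchSwinnertonDyer.Theorems.MuZeroCMKatzFrame.exists_isCyclotomic_isTopGenerator_normalised
      (K := K) (p := p) hK hp2
  have hker : κ.kerSubgroup = κc.kerSubgroup := by
    rw [show κ.kerSubgroup = _ from h.cyc, show κc.kerSubgroup = _ from hcycc]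
  obtain ⟨u, hu⟩ := ZpExtension.exists_eq_unitTwist_of_kerSubgroup_eq_holds (κ := κc) hker
  have hfix : ∀ (g : absoluteGaloisGroup ℚ) (σ τ : absoluteGaloisGroup K),
      absGaloisRestrict ℚ K τ = g * absGaloisRestrict ℚ K σ * g⁻¹ → κ τ = κ σ := by
    intro g σ τ hστ
    rw [hu, ZpExtension.unitTwist_apply, ZpExtension.unitTwist_apply, hfixc g σ τ hστ]
  -- (3) the anticyclotomic line and an adapted generator pair through `(κ γ, 0) = (1, 0)` and `(0, 1)`
  obtain ⟨κ₂, hκ₂⟩ := ZpExtension.exists_isAnticyclotomic_holds (K := K) (p := p) hK.1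
    (fun w ↦ IsTotallyComplex.isComplex w)
  have honto :=
    Summit.BirchSwinnertonDyer.BirchSwinnertonDyer.Theorems.IwasawaTwoVariable.exists_apply_eq_of_isAnticyclotomic_of_fixed
      hK hp2 hκ₂ hfix
  obtain ⟨γ₁, h11, h12⟩ := honto 1 0
  obtain ⟨γ₂, h21, h22⟩ := honto 0 1
  have hpair : ZpExtension.IsTopGeneratorPair κ κ₂ γ₁ γ₂ := by
    refine ⟨?_, ?_, ?_, ?_⟩
    · change κ γ₁ = Multiplicative.ofAdd 1
      rw [← h11, ofAdd_toAdd]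
    · rw [ZpExtension.mem_kerSubgroup]
      apply Multiplicative.toAdd.injective
      rw [toAdd_one]; exact h12
    · rw [ZpExtension.mem_kerSubgroup]
      apply Multiplicative.toAdd.injective
      rw [toAdd_one]; exact h21
    · change κ₂ γ₂ = Multiplicative.ofAdd 1
      rw [← h22, ofAdd_toAdd]
  have happly : κ γ₁ = κ γ := by
    rw [show κ γ = Multiplicative.ofAdd 1 from h.gen, ← h11, ofAdd_toAdd]
  -- (4) the standing setting of [YZ] §2 / [CGS] §2.4 at the node
  have hset : YanZhu2026.GreenbergSetting ιC W (W.conductorNorm ℤ) K v vbar κ κ₂ :=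
    { level := rfl
      three_le := by have := h.two_lt; omega
      goodOrd := by
        refine ⟨h.good, fun hdvd ↦ ?_⟩
        have h1 : (p : ℤ) ∣ W.frobeniusTrace p - 1 := h.anom.2.2
        have : (p : ℤ) ∣ 1 := by
          have := dvd_sub hdvd h1
          simpa using this
        exact hp.one_lt.ne' (by exact_mod_cast Int.eq_one_of_dvd_one (by positivity) this)
      isImaginaryQuadratic := hK
      split := h.split
      mem_v := hv
      mem_vbar := hvbar
      vbar_ne := hne
      compat := hιC
      coprime :=
        Summit.BirchSwinnertonDyer.Rank1Residual.X11b.KolyvaginAssembly.isCoprime_discr_of_satisfiesHeegnerHypothesis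
          hK h.heeg
      discr_odd := h.discr_odd
      discr_ne := h.discr_ne
      cyclotomic := h.cyc
      anticyclotomic := hκ₂ }
  -- (5) Katz / Greenberg frame at the adapted pair ([YZ] Thm. 3.9 / Def. 3.11 = [CGS] Thm. 2.4.2)
  haveI : Fact (ZpExtension.IsTopGeneratorPair κ κ₂ γ₁ γ₂) := ⟨hpair⟩
  obtain ⟨Ω, δ, Ωp, LK, G, hΩ, hδ, hkatz, hgreen⟩ := hII.1 ιC W K v vbar κ κ₂ γ₁ γ₂ hf hset
  -- (6) the structure map `ℤ_p → 𝒪_{ℂ_p}`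
  let j : ℤ_[p] →+* ℂ_[p] := (algebraMap ℚ_[p] ℂ_[p]).comp PadicInt.Coe.ringHom
  have hj : ∀ x : ℤ_[p], j x = ((x : ℚ_[p]) : ℂ_[p]) := fun x ↦ rfl
  have hmem : ∀ x : ℤ_[p], j x ∈ PadicComplexInt p := fun x ↦ by
    rw [hj, Literature.NumberTheory.EllipticCurves.mem_padicComplexInt_iff, PadicComplex.norm_extends']
    exact PadicInt.norm_le_one x
  exact ⟨⟨ιC, v, vbar, κ₂, γ₁, γ₂, hset, hpair, happly, Ω, δ, Ωp, LK, G, hΩ, hδ, hkatz, hgreen,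
    j.codRestrict (PadicComplexInt p) hmem, fun x ↦ by rw [RingHom.codRestrict_apply, hj]⟩⟩

/-- Transport of a modular parametrisation datum along an equality of levels (bookkeeping). -/
private theorem nonempty_modularParametrizationData_of_level_eq {V : WeierstrassCurve ℚ} [V.IsElliptic]
    {N M : ℕ} (h : M = N) [NeZero N] [NeZero M] :
    Nonempty (ModularParametrizationData V M) → Nonempty (ModularParametrizationData V N) := by
  subst h
  exact id

/-- **PROVED (rev 3): S1⁺ ⊕ GV — the characteristic value on the cyclotomic line equals the Greenberg value** (was
`stub_plusCharValue`, M; long form: memo Appendix H). (GL) the good lattice `E₀ ∼ E` (`exists_isIsogenous_noUnramifiedLine`) has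
`E₀(K)[p] = 0`; `MinusLineValueClass` at base `E₀` gives `char X_ac(V) = (F⁻)`, `F⁻(0) = u · X₀`, `X₀ = c⁻²(1 − a_p p⁻¹ + p⁻¹)² log_{ω}(P_K)²`;
(TR) `plusLineValue_of_minusLineValue` (CGS Prop. 3.4.2 ×2, [CGLS] Thm. 5.1.1) moves the value to the cyclotomic line; (GV) [CGLS]
Thm. 5.1.3 at `E₀` gives a BDP frame `L` with `L(𝟙) = u_B · X₀`, Yan–Zhu Prop. 3.14 (guarded) gives `(G⁻) = (J₀ L)`, so
`‖G⁻(0)‖ = ‖X₀‖` and `G⁺(0) = G(0,0) = G⁻(0)`. [cite: CastellaGrossiSkinner2025, §5 Step 1 (TeX l. 2089–2098), Prop. 2.4.5, Prop. 3.4.2]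
[cite: CastellaGrossiLeeSkinner2022, Thm. 5.1.1, Thm. 5.1.3] [cite: YanZhu2024MainConjNonCM, Prop. 3.14, §3.5]
[cite: KellerYin2024, §0.2, §1.4 (the good lattice)] -/
theorem plusCharValue_of_published :
    PublishedFacts → PublishedFactsII →
      CastellaGrossiSkinner2025.prop342_twoLineEulerChar_trivialChar → MinusLineValueClass →
        PlusCharValueEqGreenbergValue := by
  intro hI hII h342 hMV W _ _ p _ K _ _ κ γ h hN f hf hD Φ _ V _ _ hiso hVtor
  obtain ⟨-, hmodP, hmod, -, -, -, -, -, -, h511, h513⟩ := hI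
  have hpP : p.Prime := Fact.out
  have hp : 2 < p := h.two_lt
  have hp2 : p ≠ 2 := by omega
  have hK : IsImaginaryQuadratic K := h.iq
  have hHp : SatisfiesHeegnerHypothesis p K := fun q hq hqp ↦ by
    rw [(Nat.prime_dvd_prime_iff_eq hq hpP).mp hqp]
    exact h.split
  have hpN : ¬ p ∣ W.conductorNorm ℤ := fun hdvd ↦
    (dvd_conductorNorm_iff_not_hasGoodReductionAtPrime W p).mp hdvd h.good
  ------------------------------------------------------------------ (GL) the good lattice `E₀ ∼ E`
  obtain ⟨E₀, _, _, hWE₀, hGL⟩ :=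
    Summit.BirchSwinnertonDyer.Rank1Residual.X1.GoodLatticeExists.exists_isIsogenous_noUnramifiedLine
      hp h.good h.red
  have hE₀tor : ∀ Q : (E₀.baseChange K).toAffine.Point, p • Q = 0 → Q = 0 :=
    Summit.BirchSwinnertonDyer.Rank1Residual.X1.KellerYinGoodLattice.torsion_baseChange_eq_zero_of_noUnramifiedLine
      hGL hK hHp
  have hanom₀ : Anom E₀ p := h.anom.of_isIsogenous hWE₀
  have hanomV : Anom V p := h.anom.of_isIsogenous hiso
  have hE₀W : IsIsogenous E₀ W := hWE₀.symm_of_charZero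
  have hE₀V : IsIsogenous E₀ V := IsIsogenous.trans' hE₀W hiso
  -- levels (strong multiplicity one) and the newform of the class
  haveI : NeZero (E₀.conductorNorm ℤ) := ⟨(E₀.conductorNorm_pos_holds).ne'⟩
  haveI : NeZero (V.conductorNorm ℤ) := ⟨(V.conductorNorm_pos_holds).ne'⟩
  have hfE₀ : IsNewformOf E₀ f := hf.of_isIsogenous hE₀W
  have hfV : IsNewformOf V f := hf.of_isIsogenous hiso.symm_of_charZero
  have hN₀ : E₀.conductorNorm ℤ = W.conductorNorm ℤ := by
    obtain ⟨f₀, hf₀⟩ := hmod E₀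
    exact hf₀.level_eq_level hfE₀
  have hNV : V.conductorNorm ℤ = W.conductorNorm ℤ := by
    obtain ⟨f₀, hf₀⟩ := hmod V
    exact hf₀.level_eq_level hfV
  have hH₀ : SatisfiesHeegnerHypothesis (E₀.conductorNorm ℤ) K := hN₀ ▸ h.heeg
  have hHV : SatisfiesHeegnerHypothesis (V.conductorNorm ℤ) K := hNV ▸ h.heeg
  -- modular parametrisation of `E₀` at level `N_E`, a Heegner datum and a Heegner point over `K`
  obtain ⟨Dt⟩ : Nonempty (ModularParametrizationData E₀ (W.conductorNorm ℤ)) :=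
    nonempty_modularParametrizationData_of_level_eq hN₀ (hmodP E₀)
  have hDtf : Dt.f = f := Dt.isNewformOf.unique hfE₀
  obtain ⟨β, hβ⟩ := Quadratic.exists_dvd_sq_sub_discr_of_ncard_primesOver hK.1
    (NeZero.ne (W.conductorNorm ℤ)) h.heeg
  obtain ⟨H, -⟩ := exists_heegnerDatum (W.conductorNorm ℤ) hK.discr_neg hβ
  obtain ⟨w⟩ : Nonempty (InfinitePlace K) := inferInstance
  obtain ⟨P, hP⟩ := exists_map_eq_heegnerPointComplex hK Dt H w.embedding
  -- the embedding `K → ℚ_p` inducing the frame's prime `v`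
  obtain ⟨he1, hf1⟩ := Summit.BirchSwinnertonDyer.Rank1Residual.X11b.degreeOne_of_splitsIn hK.1
    (hHp p hpP dvd_rfl) Φ.setting.mem_v
  obtain ⟨e, hev⟩ : ∃ e : K →+* ℚ_[p], ∀ x : 𝓞 K, x ∈ Φ.v.asIdeal ↔ ‖e (x : K)‖ < 1 :=
    ⟨_, Summit.BirchSwinnertonDyer.Rank1Residual.X11b.mem_asIdeal_iff_norm_embAt_lt_one Φ.v
      Φ.setting.mem_v he1 hf1⟩
  -- rank, `Ш[p^∞]` and the Selmer corank along the class over `K`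
  have hisoK₀ : IsIsogenous (W.baseChange K) (E₀.baseChange K) := hWE₀.extendScalars K
  have hisoKV : IsIsogenous (W.baseChange K) (V.baseChange K) := hiso.extendScalars K
  have hrank₀ : (E₀.baseChange K).mordellWeilRank = 1 := by
    rw [← hisoK₀.mordellWeilRank_eq]; exact h.rank
  have hrankV : (V.baseChange K).mordellWeilRank = 1 := by
    rw [← hisoKV.mordellWeilRank_eq]; exact h.rank
  have hfin₀ : Finite (AddCommGroup.primaryComponent (E₀.baseChange K).sha p) := by
    rw [finite_primaryComponent_sha_iff_shaCorank_eq_zero, ← hisoK₀.shaCorank_eq p]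
    exact (finite_primaryComponent_sha_iff_shaCorank_eq_zero _ p).mp h.sha
  have hfinV : Finite (AddCommGroup.primaryComponent (V.baseChange K).sha p) := by
    rw [finite_primaryComponent_sha_iff_shaCorank_eq_zero, ← hisoKV.shaCorank_eq p]
    exact (finite_primaryComponent_sha_iff_shaCorank_eq_zero _ p).mp h.sha
  have hSel₀ : (E₀.baseChange K).selmerCorank p = 1 :=
    (CastellaGrossiSkinner2025.selmerCorank_eq_one_and_exists_not_isOfFinAddOrder E₀ p
      ((E₀.baseChange K).selmerCorank_eq_mordellWeilRank_add_holds) hrank₀ hfin₀).1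
  ------------------------------------------------------------------ (TR) the Selmer side at `V`
  -- `MinusLineValueClass` at base `E₀`, member `V`: the value on every anticyclotomic line
  have hminus : ∀ (κm : ZpExtension K p), κm.IsAnticyclotomic →
      ∀ (γm : absoluteGaloisGroup K) [Fact (κm.IsTopGenerator γm)],
        ∃ F : IwasawaAlgebra p,
          AcSelmer.XAc.charIdeal (V.baseChange K) p κm Φ.vbar ∅ γm = Ideal.span {F} ∧
          ∃ u : ℤ_[p]ˣ, ((PowerSeries.constantCoeff F : ℤ_[p]) : ℚ_[p]) =
            ((u : ℤ_[p]) : ℚ_[p]) * (((Dt.c : ℚ_[p])⁻¹) ^ 2 *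
              (1 - (E₀.frobeniusTrace p : ℚ_[p]) * (p : ℚ_[p])⁻¹ + (p : ℚ_[p])⁻¹) ^ 2 *
              (padicLogOmega E₀ p e P) ^ 2) := by
    intro κm hκm γm _
    obtain ⟨-, F, hF, u, hu⟩ := hMV E₀ p hp hanom₀.2.1 hanom₀.1 hanom₀ hGL K hK hH₀ hHp h.discr_odd
      h.discr_ne hE₀tor hSel₀ e Φ.v Φ.vbar hev Φ.setting.mem_vbar Φ.setting.vbar_ne κm hκm γm
      (W.conductorNorm ℤ) Dt H w.embedding P hP V hE₀V
    refine ⟨F, hF, u, ?_⟩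
    rw [hu]
    simp only [padicLogOmega]
    ring
  have hordV : GoodOrd V p := goodOrd_of_anom V p hanomV
  obtain ⟨htor, F, hF, hF0, u', hu'⟩ :=
    Summit.BirchSwinnertonDyer.BirchSwinnertonDyer.Theorems.InterludeWithTorsion.plusLineValue_of_minusLineValue
      h511 h342 V p hp hordV K hK hHV hHp hVtor hrankV hfinV e Φ.v Φ.vbar hev Φ.setting.mem_vbar
      Φ.setting.vbar_ne κ Φ.setting.cyclotomic Φ.γ₁ _ hminus
  refine ⟨htor, F, hF, hF0, ?_⟩
  ------------------------------------------------------------------ (GV) the analytic side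
  -- [CGLS] Thm. 5.1.3 at `E₀`: a BDP frame with the displayed value at `𝟙`, for the node's newform
  obtain ⟨ΩK, Ωp', L, hΩK, hBDP, uB, hval⟩ := h513 Φ.ιC E₀ K Φ.v Φ.κ₂ Φ.γ₂ Dt H w e P hp2 hpN hK
    h.split Φ.setting.mem_v Φ.setting.compat h.heeg h.discr_odd h.discr_ne Φ.setting.anticyclotomic
    Φ.pair.2.2.2 hP hev
  rw [hDtf] at hBDP
  -- Yan–Zhu Prop. 3.14 (guarded): `(G⁻) = (J₀ L)` in `𝒪_{ℂ_p}⟦T⟧`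
  haveI : Fact (ZpExtension.IsTopGeneratorPair κ Φ.κ₂ Φ.γ₁ Φ.γ₂) := ⟨Φ.pair⟩
  let J₀ : unrIntegers p →+* PadicComplexInt p :=
    (unrIntegers p).subtype.codRestrict (PadicComplexInt p) (fun x ↦ unrIntegers_le_padicComplexInt x.2)
  have hJ₀ : ∀ x : unrIntegers p, ((J₀ x : PadicComplexInt p) : ℂ_[p]) = (x : ℂ_[p]) := fun _ ↦ rfl
  have hspan := hII.2 Φ.ιC W K Φ.v Φ.vbar κ Φ.κ₂ Φ.γ₁ Φ.γ₂ hf Φ.setting h.heeg Φ.Ω Φ.δ Φ.Ωp Φ.LK Φ.G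
    Φ.Ω_ne Φ.δ_sq Φ.katz Φ.green ΩK Ωp' L hΩK hBDP J₀ hJ₀
  obtain ⟨U, hU⟩ := Ideal.span_singleton_eq_span_singleton.mp hspan
  have hc : PowerSeries.constantCoeff (UnrSeries₂.minus Φ.G) *
      PowerSeries.constantCoeff (U : PowerSeries (PadicComplexInt p)) = J₀ (PowerSeries.constantCoeff L) := by
    rw [← map_mul, hU]
    simp only [← PowerSeries.coeff_zero_eq_constantCoeff_apply, PowerSeries.coeff_map]
  have hU1 : ‖((PowerSeries.constantCoeff (U : PowerSeries (PadicComplexInt p)) : PadicComplexInt p) : ℂ_[p])‖ = 1 :=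
    isUnit_padicComplexInt_iff.mp (U.isUnit.map (PowerSeries.constantCoeff (R := PadicComplexInt p)))
  have huB : ‖((uB : unrIntegers p) : ℂ_[p])‖ = 1 := by
    rw [← hJ₀]; exact isUnit_padicComplexInt_iff.mp (uB.isUnit.map J₀)
  -- `‖G⁻(0)‖ = ‖L(0)‖`
  have hGL0 : ‖((PowerSeries.constantCoeff (UnrSeries₂.minus Φ.G) : PadicComplexInt p) : ℂ_[p])‖ =
      ‖((PowerSeries.constantCoeff L : unrIntegers p) : ℂ_[p])‖ := by
    rw [← hJ₀, ← hc]
    push_cast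
    rw [norm_mul, hU1, mul_one]
  -- `G⁺(0) = G(0,0) = G⁻(0)`
  have hpm : PowerSeries.constantCoeff (UnrSeries₂.plus Φ.G) = PowerSeries.constantCoeff (UnrSeries₂.minus Φ.G) := by
    simp only [← PowerSeries.coeff_zero_eq_constantCoeff_apply, UnrSeries₂.coeff_plus, UnrSeries₂.coeff_minus]
  -- `L(0) = u_B · X₀` (value at `𝟙` is the constant term)
  have hv0 := UnrSeries.eq_constantCoeff_of_hasValueAt_zero hval
  have key : ∀ x : ℚ_[p], ‖(x : ℂ_[p])‖ = ‖x‖ := fun x ↦ norm_algebraMap' ℂ_[p] x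
  have hu1 : ‖((u' : ℤ_[p]) : ℚ_[p])‖ = 1 := PadicInt.isUnit_iff.mp u'.isUnit
  rw [hpm, hGL0, ← hv0, norm_mul, huB, one_mul, norm_algebraMap', key, hu', norm_mul, hu1, one_mul]

end Summit.BirchSwinnertonDyer.BirchSwinnertonDyer.Theorems.InterludeWithTorsion

end
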